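import Literature.MathematicalPhysics.QuantumFieldTheory.Balaban1983to89.StrongCouplingKPWindow
import Summits.Ventures.LatticeQCDFlow.Scoring.OnePlaquetteSU2Characters
import Summits.QuantumFields.YangMills.Theorems.Instrument.BesselRatioEnclosures
import Mathlib.Analysis.Convex.SpecificFunctions.Basic
import Mathlib.Analysis.SpecialFunctions.Integrals.Basic
import Mathlib.Analysis.Complex.Exponential
import Literature.MathematicalPhysics.QuantumFieldTheory.MagnenRivasseauSeneor1993.MRS93OneLoopCounterterms
import HarnessLib

/-!
# Instrument cell `ym-instrument`, crew (b): the TREE's Mayer sup-activity `activitySupSU2` of the `SU(2)` plaquette gas IN CLOSED FORM —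
# `c₀(β_W) = I₀(β_W) − I₂(β_W)`, `1 ≤ c₀ ≤ cosh β_W`, `activitySupSU2 β_W = e^{β_W}/c₀ − 1 ≤ e^{β_W} − 1` (`β_W ≥ 0`) — and a kernel enclosure at `β_W = 9/200`

QUESTIONS.md rows: Q-B1 / Q-B2 (REGISTERED 2026-08-26T13:54:11Z; A-0826-8); certs/b/FORMAT.md v1 §3a/§3b (activity column, KP object); sc-ref TYPING MEMO
17:45:09Z; cell `run/shared/lean/pub/ym-instrument/`, HUMAN RULING D-0084 (2), director-ym R138; no currency row.  HONEST FRAMING (page 1, binding).  WHAT IS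
CERTIFIED HERE AND AT WHICH `(G, D, L, β)`: one-plaquette `SU(2)` analysis only; NOTHING about the `D = 4` theory beyond re-expressing two DEFINITIONS of the tree's
conditional Kotecký–Preiss window file `Balaban1983to89.StrongCouplingKPWindow`: the Haar mean `haarMeanSU2 β_W = (2/π)∫₀^π e^{β_W cos θ} sin²θ dθ` of the
one-plaquette weight and the sup-norm Mayer activity `activitySupSU2 β_W = max(e^{β_W}/c₀ − 1, 1 − e^{−β_W}/c₀)` that enters the tree's `KPCriterionSU2`.  PROVED:
`haarMeanSU2 β = I₀(β) − I₂(β)` (tree `Scoring.onePlaquetteZSU2_eq`), `1 ≤ haarMeanSU2 β` (`e^x ≥ 1 + x`, `∫ sin² = π/2` — the tree's `MRS93…OneLoop.integral_sin_sq_zero_pi` —, `∫ cos·sin² = 0`),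
`haarMeanSU2 β ≤ cosh β` (chord of the convex `exp` on `[−β, β]`), hence ★ `activitySupSU2_eq` (the `max` is its first branch, every real `β`), `activitySupSU2 β ≤ e^β − 1` (all `β`), `0 ≤ activitySupSU2 β` (`β ≥ 0`),
the window bound `activitySupSU2 β ≤ e^{β₀} − 1` for `β ≤ β₀`, and a kernel enclosure ★ `activitySupSU2_9_200_le : activitySupSU2 (9/200) ≤ 45763128782·10⁻¹²`
(`e^{β}` by `Real.exp_bound'`, `I₀ − I₂` by the landed Bessel checker).  By the character expansion at `U = 1` this activity equals the character majorant
`w = Σ_l l² v_l` of RADIUS-DERIVATION §1.4 (sc-ref's identity; the landed `CharacterActivityGrid9.w_encl_9` encloses `w(9/200) ∈ [0.045763128757, 0.045763128896]` —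
consistent; the identity itself is NOT typed here).  NOT a radius, NOT a rate, NOT summit-bearing: `KPCriterionSU2`/`ExpClusteringOfKPCriterion` stay the
tree's conditional objects; this file only makes their activity input computable in the kernel.
-/

noncomputable section

open Real MeasureTheory intervalIntegral Set Finset
open Literature.Analysis.FunctionSpaces (besselI)
open Literature.MathematicalPhysics.QuantumFieldTheory.Balaban1983to89.StrongCouplingKPWindow (haarMeanSU2 activitySupSU2)
open Summit.Ventures.LatticeQCDFlow.Scoring (onePlaquetteZSU2 onePlaquetteZSU2_eq onePlaquetteZSU2_pos)
open Summit.QuantumFields.YangMills.Theorems.Instrument.BesselRatioEnclosures (bPartialQ bTailQ bRatioQ bracket_cast)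
open Literature.MathematicalPhysics.QuantumFieldTheory.MagnenRivasseauSeneor1993.OneLoop (integral_sin_sq_zero_pi)

namespace Summit.QuantumFields.YangMills.Theorems.Instrument.ActivitySupSU2Bounds

/-! ## §1 `c₀ = I₀ − I₂`, `1 ≤ c₀ ≤ cosh β` -/

/-- `haarMeanSU2 β = (2/π)·Z₂(β)` with the LatticeQCDFlow one-plaquette normalisation `Z₂(β) = ∫₀^π sin²α e^{β cos α} dα`. [folklore] -/
theorem haarMeanSU2_eq_mul_onePlaquetteZSU2 (β : ℝ) : haarMeanSU2 β = 2 / π * onePlaquetteZSU2 β := by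
  unfold haarMeanSU2 onePlaquetteZSU2
  congr 1
  exact intervalIntegral.integral_congr fun θ _ => by simp only [mul_comm]

/-- ★ **`c₀(β) = I₀(β) − I₂(β)`** (the tree's docstring identity `c₀ = 2I₁/β`, in the recurrence-free form; `Scoring.onePlaquetteZSU2_eq`). [folklore] -/
theorem haarMeanSU2_eq_besselI (β : ℝ) : haarMeanSU2 β = besselI 0 β - besselI 2 β := by
  rw [haarMeanSU2_eq_mul_onePlaquetteZSU2, onePlaquetteZSU2_eq]
  have hπ : (π : ℝ) ≠ 0 := Real.pi_ne_zero
  field_simp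

/-- `c₀(β) > 0`. [folklore] -/
theorem haarMeanSU2_pos (β : ℝ) : 0 < haarMeanSU2 β := by
  rw [haarMeanSU2_eq_mul_onePlaquetteZSU2]
  exact mul_pos (by positivity) (onePlaquetteZSU2_pos β)

/-- `∫₀^π cos θ · sin²θ dθ = 0`. [folklore] -/
theorem integral_cos_mul_sin_sq_zero_pi : ∫ θ in (0 : ℝ)..π, Real.cos θ * Real.sin θ ^ 2 = 0 := by
  have h := integral_sin_pow_mul_cos_pow_odd (a := 0) (b := π) 2 0
  simp only [Nat.mul_zero, zero_add, pow_one, pow_zero, mul_one, Real.sin_zero, Real.sin_pi] at h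
  rw [show (fun θ => Real.cos θ * Real.sin θ ^ 2) = fun θ => Real.sin θ ^ 2 * Real.cos θ from funext fun θ => mul_comm _ _]
  rw [h, intervalIntegral.integral_same]

/-- The affine comparison integral: `(2/π)∫₀^π (A + B cos θ) sin²θ dθ = A`. [folklore] -/
theorem integral_affine_mul_sin_sq (A B : ℝ) :
    2 / π * ∫ θ in (0 : ℝ)..π, (A + B * Real.cos θ) * Real.sin θ ^ 2 = A := by
  have h1 : (fun θ => (A + B * Real.cos θ) * Real.sin θ ^ 2) =
      fun θ => A * Real.sin θ ^ 2 + B * (Real.cos θ * Real.sin θ ^ 2) := funext fun θ => by ring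
  rw [h1, intervalIntegral.integral_add ((by fun_prop : Continuous fun θ => A * Real.sin θ ^ 2).intervalIntegrable _ _)
    ((by fun_prop : Continuous fun θ => B * (Real.cos θ * Real.sin θ ^ 2)).intervalIntegrable _ _), intervalIntegral.integral_const_mul,
    intervalIntegral.integral_const_mul, integral_sin_sq_zero_pi, integral_cos_mul_sin_sq_zero_pi]
  have hπ : (π : ℝ) ≠ 0 := Real.pi_ne_zero
  field_simp
  ring

/-- ★ **`1 ≤ c₀(β)`** (every real `β`: `e^{β cos θ} ≥ 1 + β cos θ`, integrated against `(2/π) sin²θ`; the `cos` term drops). [folklore] -/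
theorem one_le_haarMeanSU2 (β : ℝ) : 1 ≤ haarMeanSU2 β := by
  have hle : ∫ θ in (0 : ℝ)..π, (1 + β * Real.cos θ) * Real.sin θ ^ 2 ≤
      ∫ θ in (0 : ℝ)..π, Real.exp (β * Real.cos θ) * Real.sin θ ^ 2 := by
    refine intervalIntegral.integral_mono_on Real.pi_pos.le
      ((by fun_prop : Continuous fun θ => (1 + β * Real.cos θ) * Real.sin θ ^ 2).intervalIntegrable _ _)
      ((by fun_prop : Continuous fun θ => Real.exp (β * Real.cos θ) * Real.sin θ ^ 2).intervalIntegrable _ _) fun θ _ => ?_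
    exact mul_le_mul_of_nonneg_right (by linarith [Real.add_one_le_exp (β * Real.cos θ)]) (sq_nonneg _)
  have h := integral_affine_mul_sin_sq 1 β
  unfold haarMeanSU2
  have hπ : 0 < 2 / π := by positivity
  calc (1 : ℝ) = 2 / π * ∫ θ in (0 : ℝ)..π, (1 + β * Real.cos θ) * Real.sin θ ^ 2 := h.symm
    _ ≤ 2 / π * ∫ θ in (0 : ℝ)..π, Real.exp (β * Real.cos θ) * Real.sin θ ^ 2 := mul_le_mul_of_nonneg_left hle hπ.le

/-- The chord of `exp` over `[−β, β]`: `e^{βc} ≤ cosh β + c·sinh β` for `|c| ≤ 1` (convexity of `exp`). [folklore] -/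
theorem exp_mul_le_cosh_add {β c : ℝ} (hc : |c| ≤ 1) : Real.exp (β * c) ≤ Real.cosh β + c * Real.sinh β := by
  have hc' := abs_le.1 hc
  have ha : 0 ≤ (1 - c) / 2 := by linarith
  have hb : 0 ≤ (1 + c) / 2 := by linarith
  have hab : (1 - c) / 2 + (1 + c) / 2 = 1 := by ring
  have h := convexOn_exp.2 (mem_univ (-β)) (mem_univ β) ha hb hab
  simp only [smul_eq_mul] at h
  rw [show (1 - c) / 2 * -β + (1 + c) / 2 * β = β * c by ring] at h
  rw [Real.cosh_eq, Real.sinh_eq]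
  linarith

/-- ★ **`c₀(β) ≤ cosh β`** (the chord bound integrated; the `sinh` term integrates to zero). [folklore] -/
theorem haarMeanSU2_le_cosh (β : ℝ) : haarMeanSU2 β ≤ Real.cosh β := by
  have hle : ∫ θ in (0 : ℝ)..π, Real.exp (β * Real.cos θ) * Real.sin θ ^ 2 ≤
      ∫ θ in (0 : ℝ)..π, (Real.cosh β + Real.sinh β * Real.cos θ) * Real.sin θ ^ 2 := by
    refine intervalIntegral.integral_mono_on Real.pi_pos.le
      ((by fun_prop : Continuous fun θ => Real.exp (β * Real.cos θ) * Real.sin θ ^ 2).intervalIntegrable _ _)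
      ((by fun_prop : Continuous fun θ => (Real.cosh β + Real.sinh β * Real.cos θ) * Real.sin θ ^ 2).intervalIntegrable _ _)
      fun θ _ => ?_
    refine mul_le_mul_of_nonneg_right ?_ (sq_nonneg _)
    have h := exp_mul_le_cosh_add (β := β) (Real.abs_cos_le_one θ)
    linarith [mul_comm (Real.cos θ) (Real.sinh β)]
  have h := integral_affine_mul_sin_sq (Real.cosh β) (Real.sinh β)
  unfold haarMeanSU2
  have hπ : 0 < 2 / π := by positivity
  calc 2 / π * ∫ θ in (0 : ℝ)..π, Real.exp (β * Real.cos θ) * Real.sin θ ^ 2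
      ≤ 2 / π * ∫ θ in (0 : ℝ)..π, (Real.cosh β + Real.sinh β * Real.cos θ) * Real.sin θ ^ 2 := mul_le_mul_of_nonneg_left hle hπ.le
    _ = Real.cosh β := h

/-! ## §2 ★ The activity in closed form and its bounds -/

/-- ★ **`activitySupSU2 β = e^β/c₀(β) − 1` (every real `β`)**: the `max` in the tree's definition is attained at `U = 1` — the second branch
`1 − e^{−β}/c₀` is below the first iff `c₀ ≤ cosh β`, which always holds. [folklore] -/
theorem activitySupSU2_eq (β : ℝ) : activitySupSU2 β = Real.exp β / haarMeanSU2 β - 1 := by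
  unfold activitySupSU2
  have hc := haarMeanSU2_pos β
  have hcosh := haarMeanSU2_le_cosh β
  refine max_eq_left ?_
  rw [Real.cosh_eq] at hcosh
  have key : 2 * haarMeanSU2 β ≤ Real.exp β + Real.exp (-β) := by linarith
  have h2 : 2 ≤ (Real.exp β + Real.exp (-β)) / haarMeanSU2 β := by rw [le_div_iff₀ hc]; linarith
  have h3 : (Real.exp β + Real.exp (-β)) / haarMeanSU2 β = Real.exp β / haarMeanSU2 β + Real.exp (-β) / haarMeanSU2 β :=
    add_div _ _ _
  linarith

/-- `0 ≤ activitySupSU2 β` for `β ≥ 0` (`c₀ ≤ cosh β ≤ e^β`). [folklore] -/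
theorem activitySupSU2_nonneg {β : ℝ} (hβ : 0 ≤ β) : 0 ≤ activitySupSU2 β := by
  rw [activitySupSU2_eq, sub_nonneg, le_div_iff₀ (haarMeanSU2_pos β), one_mul]
  have h1 := haarMeanSU2_le_cosh β
  have h2 : Real.cosh β ≤ Real.exp β := by
    rw [Real.cosh_eq]
    have : Real.exp (-β) ≤ Real.exp β := Real.exp_le_exp.2 (by linarith)
    linarith
  exact h1.trans h2

/-- ★ **`activitySupSU2 β ≤ e^β − 1`** (every real `β`; `c₀ ≥ 1`). [folklore] -/
theorem activitySupSU2_le_exp_sub_one (β : ℝ) : activitySupSU2 β ≤ Real.exp β - 1 := by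
  rw [activitySupSU2_eq]
  have h := div_le_self (Real.exp_pos β).le (one_le_haarMeanSU2 β)
  linarith

/-- **Window form**: `β ≤ β₀ ⟹ activitySupSU2 β ≤ e^{β₀} − 1` — a monotonicity-free uniform activity bound for the KP sum. [folklore] -/
theorem activitySupSU2_le_of_le {β β₀ : ℝ} (hle : β ≤ β₀) : activitySupSU2 β ≤ Real.exp β₀ - 1 :=
  (activitySupSU2_le_exp_sub_one β).trans (by linarith [Real.exp_le_exp.2 hle])

/-! ## §3 A kernel enclosure: `activitySupSU2 (9/200) ≤ 45763128782·10⁻¹²` -/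

/-- `e^{9/200} ≤ 104602785990872/10¹⁴` (`Real.exp_bound'`, 8 Taylor terms; true value `1.0460278599087…`). [folklore] -/
theorem exp_9_200_le : Real.exp ((9 : ℝ) / 200) ≤ (104602785990872 : ℝ) / 100000000000000 := by
  have h := Real.exp_bound' (x := (9 : ℝ) / 200) (by norm_num) (by norm_num) (n := 8) (by norm_num)
  refine h.trans ?_
  simp only [Finset.sum_range_succ, Finset.sum_range_zero, Nat.factorial]
  norm_num

/-- `I₀(9/200) − I₂(9/200) ≥ 100025314635832/10¹⁴` (landed Bessel brackets: lower partial sum of `I₀`, upper `partial + tail` of `I₂`). [folklore] -/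
theorem haarMeanSU2_9_200_ge : (100025314635832 : ℝ) / 100000000000000 ≤ haarMeanSU2 ((9 : ℝ) / 200) := by
  rw [haarMeanSU2_eq_besselI]
  have h0 := bracket_cast 0 (x := 9 / 200) (by norm_num) (K := 6) (by decide +kernel)
  have h2 := bracket_cast 2 (x := 9 / 200) (by norm_num) (K := 6) (by decide +kernel)
  have e0 : ((100025314635832 : ℚ) / 100000000000000 : ℚ) ≤ bPartialQ 0 (9 / 200) 6 - (bPartialQ 2 (9 / 200) 6 + bTailQ 2 (9 / 200) 6) := by
    decide +kernel
  have e0' : ((100025314635832 : ℝ) / 100000000000000) ≤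
      ((bPartialQ 0 (9 / 200) 6 : ℚ) : ℝ) - (((bPartialQ 2 (9 / 200) 6 : ℚ) : ℝ) + ((bTailQ 2 (9 / 200) 6 : ℚ) : ℝ)) := by
    have h := (Rat.cast_le (K := ℝ)).2 e0
    push_cast at h
    exact h
  push_cast at h0 h2
  linarith [h0.1, h2.2]

/-- ★ **`activitySupSU2 (9/200) ≤ 45763128782·10⁻¹²`** (`= 0.045763128782`; the character majorant `w(9/200)` of `CharacterActivityGrid9.w_encl_9` lies in
`[0.045763128757, 0.045763128896]` — the same number to `10⁻¹⁰`, as sc-ref's identity `w = e^β/c₀ − 1` predicts). [folklore] -/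
theorem activitySupSU2_9_200_le : activitySupSU2 ((9 : ℝ) / 200) ≤ (45763128782 : ℝ) / 1000000000000 := by
  rw [activitySupSU2_eq]
  have he := exp_9_200_le
  have hc := haarMeanSU2_9_200_ge
  have hcpos : (0 : ℝ) < (100025314635832 : ℝ) / 100000000000000 := by norm_num
  have h1 : Real.exp ((9 : ℝ) / 200) / haarMeanSU2 ((9 : ℝ) / 200) ≤
      ((104602785990872 : ℝ) / 100000000000000) / ((100025314635832 : ℝ) / 100000000000000) :=
    div_le_div₀ (by norm_num) he hcpos hc
  refine le_trans (sub_le_sub_right h1 1) ?_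
  norm_num

end Summit.QuantumFields.YangMills.Theorems.Instrument.ActivitySupSU2Bounds

end
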